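import Summits.CriticalPhenomena.PercolationContinuityZ3.Theorems.PercNearOneGluingAdditiveGluingSepCaptureAux
import Mathlib.Combinatorics.SetFamily.FourFunctions
import HarnessLib

/-!
# Crux `PercNearOneGluing.AdditiveGluing` (stmt-CriticalPhenomena-4576) — the Ahlswede–Daykin / Harris
# four-event inequality for connectivity events of an ARBITRARY finite terminal set, CONDITIONED ON THE ISOLATION
# of vertex sets — part I: the induction on `G[U]`

Helper file (task `png-dp-al5`, gen 3; `--supports stmt-CriticalPhenomena-4576`); the terminal-SET version of
`…CondAD.lean` (three named terminals) and `…SepCapture.lean`.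

Bond percolation with arbitrary edge probabilities on a finite vertex type (`μ = prodBernoulli w`), a finite
set `Tm` of vertices ("terminals").  A TERMINAL EVENT is an event `{ω | P (↔)}` where `P` is a predicate of the
connection relation `↔` that only reads it on `Tm × Tm` monotonically: increasing if
`(∀ x y ∈ Tm, r x y → r' x y) → P r → P r'`, decreasing if the same with `r, r'` exchanged in the hypothesis
(hypotheses spelled out; no definition is introduced).  For a vertex set `W` write
`I_W = Tm ↮ W = {∀ t ∈ Tm, ∀ x ∈ W, t ↮ x}`.

**Theorem (`condADT_core`, measure form `condADT_two_sets` in part II).**  For increasing terminal events `A₁, A₂`, decreasing terminal events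
`D₁, D₂` and vertex sets `S, T`:

  `μ(A₁ ∩ D₁ ∩ I_S) · μ(A₂ ∩ D₂ ∩ I_T) ≤ μ(A₁ ∩ A₂ ∩ I_{S∩T}) · μ(D₁ ∩ D₂ ∩ I_{S∪T})`.

For `S = T = ∅` this is the Ahlswede–Daykin four-event inequality (Harris–FKG in product form); the point is
that it SURVIVES CONDITIONING ON THE ISOLATION EVENTS `I_S, I_T` (decreasing events, for which no FKG
structure is available in general), with the intersection/union bookkeeping of van den Berg–Kahn 2001 /
BHK 2006 Thm. 1.1.  Corollaries (`S = T = W`): given `I_W`, increasing terminal events are positively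
correlated (`condHarrisT_isolated`, part II); with `Tm = {o,a,b}` one recovers `…CondAD.lean` and the
separated-capture inequality `P(oa|b|c)·P(ob|a|c) ≤ P(oab|c)·P(o|a|b|c)` of `…SepCapture.lean`; with
`Tm = {o, a_i, a_j, b}`, `W = {a_k}` one gets the dilution-free five-terminal rows asked for by the AG(3)
certificate searches of this crux (memo SEPCAPTURE.md).  Terminal events are NOT measurable with respect to
the cluster of one vertex (or two), so this is not a case of BHK's Thms. 1.1–1.5; and given `I_W` the join of two
configurations does not preserve `I_W`, so it is not a case of Ahlswede–Daykin either.

## Proof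

Verbatim the induction of `…SepCapture.lean` / `BHK2006.core` ([VandenbergKahn2001, proof of Thm. 1.2];
[VandenbergHaggstromKahn2005, Thm. 1.1, pp. 3–5]): strong induction on the vertex set `U` of the restricted
model `G[U]`; if `Z := S ∩ T ∩ U = ∅`, the four functions theorem on the configuration lattice (the join of
`α ∈ A₁ ∩ D₁ ∩ I_S` and `β ∈ A₂ ∩ D₂ ∩ I_T` lies in `A₁ ∩ A₂`, the meet in `D₁ ∩ D₂ ∩ I_{S∪T}`); otherwise condition on the set `R` of
vertices of `U ∖ Z` with an open edge to `Z`: on `I_Z` every terminal event of `G[U]` is the same terminal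
event of `G[U ∖ Z]` and `I_W` becomes `I_{(W∖Z) ∪ R}` (BHK's identity (6) for every terminal as a source), the law of `R` is a product weight, and Ahlswede–Daykin over `R` with the induction
hypothesis for `G[U ∖ Z]` closes the step.

## References
* J. van den Berg, J. Kahn, Ann. Probab. 29 (2001) 123–126, Thm. 1.2 and its proof. [VandenbergKahn2001]
* J. van den Berg, O. Häggström, J. Kahn, RSA 29 (2006) 417–435, Thm. 1.1 (pp. 3–5). [VandenbergHaggstromKahn2005]
* R. Ahlswede, D. E. Daykin (1978) (Mathlib `four_functions_theorem_univ`).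
-/

noncomputable section

open MeasureTheory
open Literature.Probability.LatticeModels (prodBernoulli)
open Literature.Probability.Percolation
open Literature.Probability.Percolation.BHK2006
open DecisionTree (ind ind_of_mem ind_of_not_mem ind_nonneg)

namespace Summit.CriticalPhenomena.PercolationContinuityZ3.Theorems

open scoped Classical

variable {V : Type*}

/-! Local notations (no new definitions): `rAVT[U, Tm, W]` = the isolation event `Tm ↮ W` in `G[U]`;
`rEVT[U, P]` = the event of the predicate `P` of the reachability relation of `G[U]`. -/
local notation3 "rAVT[" U ", " Tm ", " W "]" => {ω : Set (Sym2 V) | ∀ t ∈ (Tm : Finset V), ω ∈ rD U t W}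
local notation3 "rEVT[" U ", " P "]" =>
  {ω : Set (Sym2 V) | (P : (V → V → Prop) → Prop) (fun x y => (openGraph (ω ∩ edgesIn U)).Reachable x y)}

/-! A terminal predicate `P : (V → V → Prop) → Prop` is INCREASING on `Tm` if
`∀ r r', (∀ x ∈ Tm, ∀ y ∈ Tm, r x y → r' x y) → P r → P r'` and DECREASING on `Tm` if
`∀ r r', (∀ x ∈ Tm, ∀ y ∈ Tm, r' x y → r x y) → P r → P r'` (either implies that `P` only reads `r` on
`Tm × Tm`).  (Spelled out as hypotheses; no definition is introduced.) -/

section Events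

/-- Terminal events of `G[U ∖ Z]` do not read the edges meeting `Z`. [folklore] -/
theorem condADT_ev_diff_meeting (U Z : Finset V) (P : (V → V → Prop) → Prop) (ω : Set (Sym2 V)) :
    ω \ meeting Z ∈ rEVT[U \ Z, P] ↔ ω ∈ rEVT[U \ Z, P] := by
  simp only [Set.mem_setOf_eq, diff_meeting_inter_edgesIn]

/-- The isolation event of `G[U ∖ Z]` does not read the edges meeting `Z`. [folklore] -/
theorem condADT_av_diff_meeting (U Z Tm : Finset V) (W : Set V) (ω : Set (Sym2 V)) :
    ω \ meeting Z ∈ rAVT[U \ Z, Tm, W] ↔ ω ∈ rAVT[U \ Z, Tm, W] := by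
  simp only [Set.mem_setOf_eq, mem_rD_diff_meeting]

/-- BHK's identity (6) for every terminal as a source: for `Z ⊆ W`, `Z` disjoint from `Tm`,
`Tm ↮ W` in `G[U]` iff `Tm ↮ (W ∖ Z) ∪ S(ω)` in `G[U ∖ Z]`. [cite: VandenbergHaggstromKahn2005, §1 p. 4, identity (6)] -/
theorem condADT_av_iff {U Z Tm : Finset V} (hZU : Z ⊆ U) (hTZ : ∀ t ∈ Tm, t ∉ Z) {W : Set V}
    (hZW : (↑Z : Set V) ⊆ W) (ω : Set (Sym2 V)) :
    ω ∈ rAVT[U, Tm, W] ↔ ω ∈ rAVT[U \ Z, Tm, (W \ ↑Z) ∪ rS U Z ω] := by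
  simp only [Set.mem_setOf_eq]
  exact ⟨fun h t ht => (mem_rD_iff_restrict hZU (hTZ t ht) hZW ω).1 (h t ht),
    fun h t ht => (mem_rD_iff_restrict hZU (hTZ t ht) hZW ω).2 (h t ht)⟩

/-- BHK's identity (6) for terminal events: on the restricted isolation event, a terminal event of `G[U]`
(a predicate reading the reachability relation on `Tm × Tm` only) is the same terminal event of `G[U ∖ Z]`.
[cite: VandenbergHaggstromKahn2005, §1 p. 4, identity (6)] -/
theorem condADT_ev_iff {U Z Tm : Finset V} (hTZ : ∀ t ∈ Tm, t ∉ Z) (P : (V → V → Prop) → Prop)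
    (hP : ∀ r r' : V → V → Prop, (∀ x ∈ Tm, ∀ y ∈ Tm, (r x y ↔ r' x y)) → (P r ↔ P r'))
    {W' : Set V} {ω : Set (Sym2 V)} (hav' : ω ∈ rAVT[U \ Z, Tm, W' ∪ rS U Z ω]) :
    ω ∈ rEVT[U, P] ↔ ω ∈ rEVT[U \ Z, P] := by
  simp only [Set.mem_setOf_eq] at hav' ⊢
  refine hP _ _ fun x hx y _ => ?_
  exact SandwichK41.reachable_restrict_iff (hTZ x hx) (sepCapture_avoid_rS (hav' x hx)) y

/-- The compound event `P ∩ Q ∩ I_W` of `G[U ∖ Z]` does not read the edges meeting `Z`. [folklore] -/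
theorem condADT_E_diff_meeting (U Z Tm : Finset V) (P Q : (V → V → Prop) → Prop) (W : Set V)
    (ω : Set (Sym2 V)) :
    ω \ meeting Z ∈ rEVT[U \ Z, P] ∩ rEVT[U \ Z, Q] ∩ rAVT[U \ Z, Tm, W] ↔
      ω ∈ rEVT[U \ Z, P] ∩ rEVT[U \ Z, Q] ∩ rAVT[U \ Z, Tm, W] := by
  simp only [Set.mem_inter_iff, condADT_ev_diff_meeting, condADT_av_diff_meeting]

/-- BHK's (6) for the compound events. [cite: VandenbergHaggstromKahn2005, §1 p. 4, identity (6)] -/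
theorem condADT_E_iff {U Z Tm : Finset V} (hZU : Z ⊆ U) (hTZ : ∀ t ∈ Tm, t ∉ Z)
    (P Q : (V → V → Prop) → Prop)
    (hP : ∀ r r' : V → V → Prop, (∀ x ∈ Tm, ∀ y ∈ Tm, (r x y ↔ r' x y)) → (P r ↔ P r'))
    (hQ : ∀ r r' : V → V → Prop, (∀ x ∈ Tm, ∀ y ∈ Tm, (r x y ↔ r' x y)) → (Q r ↔ Q r'))
    {W : Set V} (hZW : (↑Z : Set V) ⊆ W) (ω : Set (Sym2 V)) :
    ω ∈ rEVT[U, P] ∩ rEVT[U, Q] ∩ rAVT[U, Tm, W] ↔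
      ω ∈ rEVT[U \ Z, P] ∩ rEVT[U \ Z, Q] ∩ rAVT[U \ Z, Tm, (W \ ↑Z) ∪ rS U Z ω] := by
  constructor
  · rintro ⟨⟨hP', hQ'⟩, hav⟩
    have hav' := (condADT_av_iff hZU hTZ hZW ω).1 hav
    exact ⟨⟨(condADT_ev_iff hTZ P hP hav').1 hP', (condADT_ev_iff hTZ Q hQ hav').1 hQ'⟩, hav'⟩
  · rintro ⟨⟨hP', hQ'⟩, hav'⟩
    exact ⟨⟨(condADT_ev_iff hTZ P hP hav').2 hP', (condADT_ev_iff hTZ Q hQ hav').2 hQ'⟩,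
      (condADT_av_iff hZU hTZ hZW ω).2 hav'⟩

/-- The isolation events are antitone in the avoided set. [cite: VandenbergHaggstromKahn2005, §1 p. 3] -/
theorem condADT_av_antitone (U Tm : Finset V) {W W' : Set V} (h : W ⊆ W') :
    rAVT[U, Tm, W'] ⊆ rAVT[U, Tm, W] := fun _ hω t ht => rD_antitone h (hω t ht)

variable [Fintype V]

/-! ### The induction -/

/-- **Conditional Ahlswede–Daykin for terminal events, restricted to `G[U]`, two isolation sets.**
For a terminal set `Tm`, increasing terminal predicates `A₁, A₂`, decreasing `D₁, D₂` and `S, T ⊆ U`: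
`μ(A₁ ∩ D₁ ∩ I_S) · μ(A₂ ∩ D₂ ∩ I_T) ≤ μ(A₁ ∩ A₂ ∩ I_{S∩T}) · μ(D₁ ∩ D₂ ∩ I_{S∪T})` (weight sums in `G[U]`).
[cite: VandenbergKahn2001, Thm. 1.2 (pp. 124–126) — method; derived in this file] -/
theorem condADT_core (w : Sym2 V → ℝ) (hw0 : ∀ e, 0 ≤ w e) (hw1 : ∀ e, w e ≤ 1)
    (hm : ∑ ω, weight w ω = 1) (U : Finset V) :
    ∀ (Tm : Finset V) (A₁ A₂ D₁ D₂ : (V → V → Prop) → Prop),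
    (∀ r r' : V → V → Prop, (∀ x ∈ Tm, ∀ y ∈ Tm, r x y → r' x y) → A₁ r → A₁ r') →
    (∀ r r' : V → V → Prop, (∀ x ∈ Tm, ∀ y ∈ Tm, r x y → r' x y) → A₂ r → A₂ r') →
    (∀ r r' : V → V → Prop, (∀ x ∈ Tm, ∀ y ∈ Tm, r' x y → r x y) → D₁ r → D₁ r') →
    (∀ r r' : V → V → Prop, (∀ x ∈ Tm, ∀ y ∈ Tm, r' x y → r x y) → D₂ r → D₂ r') →
    ∀ (S T : Set V), S ⊆ ↑U → T ⊆ ↑U →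
    (∑ ω, weight w ω * ind (rEVT[U, A₁] ∩ rEVT[U, D₁] ∩ rAVT[U, Tm, S]) ω) *
      (∑ ω, weight w ω * ind (rEVT[U, A₂] ∩ rEVT[U, D₂] ∩ rAVT[U, Tm, T]) ω) ≤
    (∑ ω, weight w ω * ind (rEVT[U, A₁] ∩ rEVT[U, A₂] ∩ rAVT[U, Tm, S ∩ T]) ω) *
      (∑ ω, weight w ω * ind (rEVT[U, D₁] ∩ rEVT[U, D₂] ∩ rAVT[U, Tm, S ∪ T]) ω) := by
  induction U using Finset.strongInduction with
  | H U ih =>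
  intro Tm A₁ A₂ D₁ D₂ hA₁ hA₂ hD₁ hD₂ S T hSU hTU
  -- a monotone or antitone predicate only reads `r` on `Tm × Tm`
  have locA₁ : ∀ r r' : V → V → Prop, (∀ x ∈ Tm, ∀ y ∈ Tm, (r x y ↔ r' x y)) → (A₁ r ↔ A₁ r') :=
    fun r r' h => ⟨hA₁ r r' fun x hx y hy => (h x hx y hy).1, hA₁ r' r fun x hx y hy => (h x hx y hy).2⟩
  have locA₂ : ∀ r r' : V → V → Prop, (∀ x ∈ Tm, ∀ y ∈ Tm, (r x y ↔ r' x y)) → (A₂ r ↔ A₂ r') :=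
    fun r r' h => ⟨hA₂ r r' fun x hx y hy => (h x hx y hy).1, hA₂ r' r fun x hx y hy => (h x hx y hy).2⟩
  have locD₁ : ∀ r r' : V → V → Prop, (∀ x ∈ Tm, ∀ y ∈ Tm, (r x y ↔ r' x y)) → (D₁ r ↔ D₁ r') :=
    fun r r' h => ⟨hD₁ r r' fun x hx y hy => (h x hx y hy).2, hD₁ r' r fun x hx y hy => (h x hx y hy).1⟩
  have locD₂ : ∀ r r' : V → V → Prop, (∀ x ∈ Tm, ∀ y ∈ Tm, (r x y ↔ r' x y)) → (D₂ r ↔ D₂ r') :=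
    fun r r' h => ⟨hD₂ r r' fun x hx y hy => (h x hx y hy).2, hD₂ r' r fun x hx y hy => (h x hx y hy).1⟩
  have hRHS : 0 ≤ (∑ ω, weight w ω * ind (rEVT[U, A₁] ∩ rEVT[U, A₂] ∩ rAVT[U, Tm, S ∩ T]) ω) *
      (∑ ω, weight w ω * ind (rEVT[U, D₁] ∩ rEVT[U, D₂] ∩ rAVT[U, Tm, S ∪ T]) ω) :=
    mul_nonneg (sepCapture_sum_nonneg hw0 hw1 _) (sepCapture_sum_nonneg hw0 hw1 _)
  -- trivial cases: a terminal lies in `S` (resp. `T`)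
  have hempty : ∀ (P Q : (V → V → Prop) → Prop) (W : Set V), (∃ t ∈ Tm, t ∈ W) →
      ∑ ω, weight w ω * ind (rEVT[U, P] ∩ rEVT[U, Q] ∩ rAVT[U, Tm, W]) ω = 0 := by
    rintro P Q W ⟨t, htT, htW⟩
    refine Finset.sum_eq_zero fun ω _ => ?_
    have hω : ω ∉ rEVT[U, P] ∩ rEVT[U, Q] ∩ rAVT[U, Tm, W] := by
      rintro ⟨-, h⟩
      exact (rD_eq_empty (U := U) (s := t) htW).le (h t htT)
    rw [ind_of_not_mem hω, mul_zero]
  by_cases hS3 : ∃ t ∈ Tm, t ∈ S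
  · rw [hempty A₁ D₁ S hS3, zero_mul]; exact hRHS
  by_cases hT3 : ∃ t ∈ Tm, t ∈ T
  · rw [hempty A₂ D₂ T hT3, mul_zero]; exact hRHS
  push Not at hS3 hT3
  set Z : Finset V := U.filter fun v => v ∈ S ∧ v ∈ T with hZ
  have hZU : Z ⊆ U := Finset.filter_subset _ _
  have hmemZ : ∀ v, v ∈ Z ↔ v ∈ S ∧ v ∈ T := fun v => by
    simp only [hZ, Finset.mem_filter, and_iff_right_iff_imp]
    exact fun h => hSU h.1
  have hTZ : ∀ t ∈ Tm, t ∉ Z := fun t ht h => hS3 t ht ((hmemZ t).1 h).1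
  have rmono : ∀ {α β : Set (Sym2 V)}, α ⊆ β → ∀ x y : V,
      (openGraph (α ∩ edgesIn U)).Reachable x y → (openGraph (β ∩ edgesIn U)).Reachable x y :=
    fun h x y hr => hr.mono (openGraph_le (Set.inter_subset_inter_left _ h))
  rcases Z.eq_empty_or_nonempty with hZe | hZne
  · /- `S ∩ T = ∅`: Ahlswede–Daykin on the configuration lattice. -/
    have hST : ∀ v, v ∈ S ∩ T → False := fun v hv => by
      have : v ∈ Z := (hmemZ v).2 hv
      rw [hZe] at this
      exact Finset.notMem_empty v this
    have key := four_functions_theorem_univ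
      (fun ω => weight w ω * ind (rEVT[U, A₁] ∩ rEVT[U, D₁] ∩ rAVT[U, Tm, S]) ω)
      (fun ω => weight w ω * ind (rEVT[U, A₂] ∩ rEVT[U, D₂] ∩ rAVT[U, Tm, T]) ω)
      (fun ω => weight w ω * ind (rEVT[U, D₁] ∩ rEVT[U, D₂] ∩ rAVT[U, Tm, S ∪ T]) ω)
      (fun ω => weight w ω * ind (rEVT[U, A₁] ∩ rEVT[U, A₂] ∩ rAVT[U, Tm, S ∩ T]) ω)
      (fun ω => mul_nonneg (weight_nonneg hw0 hw1 ω) (ind_nonneg _ _))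
      (fun ω => mul_nonneg (weight_nonneg hw0 hw1 ω) (ind_nonneg _ _))
      (fun ω => mul_nonneg (weight_nonneg hw0 hw1 ω) (ind_nonneg _ _))
      (fun ω => mul_nonneg (weight_nonneg hw0 hw1 ω) (ind_nonneg _ _))
      (fun α β => ?_)
    · rw [mul_comm (∑ ω, weight w ω * ind (rEVT[U, A₁] ∩ rEVT[U, A₂] ∩ rAVT[U, Tm, S ∩ T]) ω)]
      exact key
    by_cases hα : α ∈ rEVT[U, A₁] ∩ rEVT[U, D₁] ∩ rAVT[U, Tm, S]
    · by_cases hβ : β ∈ rEVT[U, A₂] ∩ rEVT[U, D₂] ∩ rAVT[U, Tm, T]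
      · obtain ⟨⟨hαA, hαD⟩, hαS⟩ := hα
        obtain ⟨⟨hβA, hβD⟩, hβT⟩ := hβ
        have hmeet : α ⊓ β ∈ rEVT[U, D₁] ∩ rEVT[U, D₂] ∩ rAVT[U, Tm, S ∪ T] := by
          refine ⟨⟨?_, ?_⟩, ?_⟩
          · exact hD₁ _ _ (fun x _ y _ => rmono Set.inter_subset_left x y) hαD
          · exact hD₂ _ _ (fun x _ y _ => rmono Set.inter_subset_right x y) hβD
          · intro t ht
            rw [rD_union]
            exact ⟨rD_decreasing Set.inter_subset_left (hαS t ht),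
              rD_decreasing Set.inter_subset_right (hβT t ht)⟩
        have hjoin : α ⊔ β ∈ rEVT[U, A₁] ∩ rEVT[U, A₂] ∩ rAVT[U, Tm, S ∩ T] := by
          refine ⟨⟨?_, ?_⟩, ?_⟩
          · exact hA₁ _ _ (fun x _ y _ => rmono Set.subset_union_left x y) hαA
          · exact hA₂ _ _ (fun x _ y _ => rmono Set.subset_union_right x y) hβA
          · exact fun t _ v hv _ => hST v hv
        have e1 : ind (rEVT[U, A₁] ∩ rEVT[U, D₁] ∩ rAVT[U, Tm, S]) α = 1 := ind_of_mem ⟨⟨hαA, hαD⟩, hαS⟩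
        have e2 : ind (rEVT[U, A₂] ∩ rEVT[U, D₂] ∩ rAVT[U, Tm, T]) β = 1 := ind_of_mem ⟨⟨hβA, hβD⟩, hβT⟩
        rw [e1, e2, ind_of_mem hmeet, ind_of_mem hjoin, mul_one, mul_one, mul_one, mul_one]
        exact (weight_inter_mul_union w α β).le
      · rw [ind_of_not_mem hβ, mul_zero, mul_zero]
        exact mul_nonneg (mul_nonneg (weight_nonneg hw0 hw1 _) (ind_nonneg _ _))
          (mul_nonneg (weight_nonneg hw0 hw1 _) (ind_nonneg _ _))
    · rw [ind_of_not_mem hα, mul_zero, zero_mul]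
      exact mul_nonneg (mul_nonneg (weight_nonneg hw0 hw1 _) (ind_nonneg _ _))
        (mul_nonneg (weight_nonneg hw0 hw1 _) (ind_nonneg _ _))
  · /- `Z ≠ ∅`: condition on `S(ω)`; four functions theorem with the induction hypothesis on `U ∖ Z`. -/
    have hss : U \ Z ⊂ U := Finset.sdiff_ssubset hZU hZne
    have hZS : (↑Z : Set V) ⊆ S := fun v hv => ((hmemZ v).1 hv).1
    have hZT : (↑Z : Set V) ⊆ T := fun v hv => ((hmemZ v).1 hv).2
    have hZST : (↑Z : Set V) ⊆ S ∩ T := fun v hv => (hmemZ v).1 hv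
    have hZSuT : (↑Z : Set V) ⊆ S ∪ T := fun v hv => Or.inl ((hmemZ v).1 hv).1
    have e1 := sepCapture_step_sum w hm (rEVT[U, A₁] ∩ rEVT[U, D₁] ∩ rAVT[U, Tm, S])
      (fun W => rEVT[U \ Z, A₁] ∩ rEVT[U \ Z, D₁] ∩ rAVT[U \ Z, Tm, W]) (S \ ↑Z)
      (fun R ω => condADT_E_diff_meeting U Z Tm A₁ D₁ _ ω)
      (fun ω => condADT_E_iff hZU hTZ A₁ D₁ locA₁ locD₁ hZS ω)
    have e2 := sepCapture_step_sum w hm (rEVT[U, A₂] ∩ rEVT[U, D₂] ∩ rAVT[U, Tm, T])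
      (fun W => rEVT[U \ Z, A₂] ∩ rEVT[U \ Z, D₂] ∩ rAVT[U \ Z, Tm, W]) (T \ ↑Z)
      (fun R ω => condADT_E_diff_meeting U Z Tm A₂ D₂ _ ω)
      (fun ω => condADT_E_iff hZU hTZ A₂ D₂ locA₂ locD₂ hZT ω)
    have e3 := sepCapture_step_sum w hm (rEVT[U, A₁] ∩ rEVT[U, A₂] ∩ rAVT[U, Tm, S ∩ T])
      (fun W => rEVT[U \ Z, A₁] ∩ rEVT[U \ Z, A₂] ∩ rAVT[U \ Z, Tm, W]) ((S ∩ T) \ ↑Z)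
      (fun R ω => condADT_E_diff_meeting U Z Tm A₁ A₂ _ ω)
      (fun ω => condADT_E_iff hZU hTZ A₁ A₂ locA₁ locA₂ hZST ω)
    have e4 := sepCapture_step_sum w hm (rEVT[U, D₁] ∩ rEVT[U, D₂] ∩ rAVT[U, Tm, S ∪ T])
      (fun W => rEVT[U \ Z, D₁] ∩ rEVT[U \ Z, D₂] ∩ rAVT[U \ Z, Tm, W]) ((S ∪ T) \ ↑Z)
      (fun R ω => condADT_E_diff_meeting U Z Tm D₁ D₂ _ ω)
      (fun ω => condADT_E_iff hZU hTZ D₁ D₂ locD₁ locD₂ hZSuT ω)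
    rw [e1, e2, e3, e4]
    refine four_functions_theorem_univ
      (fun ω => weight w ω * ∑ η, weight w η *
        ind (rEVT[U \ Z, A₁] ∩ rEVT[U \ Z, D₁] ∩ rAVT[U \ Z, Tm, S \ ↑Z ∪ rS U Z ω]) η)
      (fun ω => weight w ω * ∑ η, weight w η *
        ind (rEVT[U \ Z, A₂] ∩ rEVT[U \ Z, D₂] ∩ rAVT[U \ Z, Tm, T \ ↑Z ∪ rS U Z ω]) η)
      (fun ω => weight w ω * ∑ η, weight w η *
        ind (rEVT[U \ Z, A₁] ∩ rEVT[U \ Z, A₂] ∩ rAVT[U \ Z, Tm, (S ∩ T) \ ↑Z ∪ rS U Z ω]) η)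
      (fun ω => weight w ω * ∑ η, weight w η *
        ind (rEVT[U \ Z, D₁] ∩ rEVT[U \ Z, D₂] ∩ rAVT[U \ Z, Tm, (S ∪ T) \ ↑Z ∪ rS U Z ω]) η)
      (fun ω => mul_nonneg (weight_nonneg hw0 hw1 ω) (sepCapture_sum_nonneg hw0 hw1 _))
      (fun ω => mul_nonneg (weight_nonneg hw0 hw1 ω) (sepCapture_sum_nonneg hw0 hw1 _))
      (fun ω => mul_nonneg (weight_nonneg hw0 hw1 ω) (sepCapture_sum_nonneg hw0 hw1 _))
      (fun ω => mul_nonneg (weight_nonneg hw0 hw1 ω) (sepCapture_sum_nonneg hw0 hw1 _))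
      fun α β => ?_
    set Ra := rS U Z α with hRa
    set Rb := rS U Z β with hRb
    have hRaU : Ra ⊆ ↑(U \ Z) := rS_subset U Z α
    have hRbU : Rb ⊆ ↑(U \ Z) := rS_subset U Z β
    have hS1 : S \ ↑Z ∪ Ra ⊆ ↑(U \ Z) := Set.union_subset
      (fun v hv => by rw [Finset.coe_sdiff]; exact ⟨hSU hv.1, hv.2⟩) hRaU
    have hT1 : T \ ↑Z ∪ Rb ⊆ ↑(U \ Z) := Set.union_subset
      (fun v hv => by rw [Finset.coe_sdiff]; exact ⟨hTU hv.1, hv.2⟩) hRbU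
    have IH := ih (U \ Z) hss Tm A₁ A₂ D₁ D₂ hA₁ hA₂ hD₁ hD₂ (S \ ↑Z ∪ Ra) (T \ ↑Z ∪ Rb) hS1 hT1
    have hsub3 : (S ∩ T) \ ↑Z ∪ rS U Z (α ∩ β) ⊆ (S \ ↑Z ∪ Ra) ∩ (T \ ↑Z ∪ Rb) := by
      refine Set.union_subset (fun v hv => ⟨Or.inl ⟨hv.1.1, hv.2⟩, Or.inl ⟨hv.1.2, hv.2⟩⟩) ?_
      exact fun v hv =>
        ⟨Or.inr (rS_inter_subset U Z α β hv).1, Or.inr (rS_inter_subset U Z α β hv).2⟩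
    have hsub4 : (S ∪ T) \ ↑Z ∪ rS U Z (α ∪ β) ⊆ (S \ ↑Z ∪ Ra) ∪ (T \ ↑Z ∪ Rb) := by
      rw [rS_union]
      rintro v (⟨hv | hv, hvZ⟩ | hv | hv)
      · exact Or.inl (Or.inl ⟨hv, hvZ⟩)
      · exact Or.inr (Or.inl ⟨hv, hvZ⟩)
      · exact Or.inl (Or.inr hv)
      · exact Or.inr (Or.inr hv)
    have h3 : ∑ η, weight w η * ind (rEVT[U \ Z, A₁] ∩ rEVT[U \ Z, A₂] ∩
          rAVT[U \ Z, Tm, (S \ ↑Z ∪ Ra) ∩ (T \ ↑Z ∪ Rb)]) η ≤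
        ∑ η, weight w η * ind (rEVT[U \ Z, A₁] ∩ rEVT[U \ Z, A₂] ∩
          rAVT[U \ Z, Tm, (S ∩ T) \ ↑Z ∪ rS U Z (α ∩ β)]) η :=
      sepCapture_sum_mono hw0 hw1 (Set.inter_subset_inter_right _ (condADT_av_antitone (U \ Z) Tm hsub3))
    have h4 : ∑ η, weight w η * ind (rEVT[U \ Z, D₁] ∩ rEVT[U \ Z, D₂] ∩
          rAVT[U \ Z, Tm, (S \ ↑Z ∪ Ra) ∪ (T \ ↑Z ∪ Rb)]) η ≤
        ∑ η, weight w η * ind (rEVT[U \ Z, D₁] ∩ rEVT[U \ Z, D₂] ∩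
          rAVT[U \ Z, Tm, (S ∪ T) \ ↑Z ∪ rS U Z (α ∪ β)]) η :=
      sepCapture_sum_mono hw0 hw1 (Set.inter_subset_inter_right _ (condADT_av_antitone (U \ Z) Tm hsub4))
    have hIH' : (∑ η, weight w η * ind (rEVT[U \ Z, A₁] ∩ rEVT[U \ Z, D₁] ∩
          rAVT[U \ Z, Tm, S \ ↑Z ∪ Ra]) η) *
        (∑ η, weight w η * ind (rEVT[U \ Z, A₂] ∩ rEVT[U \ Z, D₂] ∩
          rAVT[U \ Z, Tm, T \ ↑Z ∪ Rb]) η) ≤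
        (∑ η, weight w η * ind (rEVT[U \ Z, A₁] ∩ rEVT[U \ Z, A₂] ∩
          rAVT[U \ Z, Tm, (S ∩ T) \ ↑Z ∪ rS U Z (α ∩ β)]) η) *
          (∑ η, weight w η * ind (rEVT[U \ Z, D₁] ∩ rEVT[U \ Z, D₂] ∩
            rAVT[U \ Z, Tm, (S ∪ T) \ ↑Z ∪ rS U Z (α ∪ β)]) η) :=
      IH.trans (mul_le_mul h3 h4 (sepCapture_sum_nonneg hw0 hw1 _) (sepCapture_sum_nonneg hw0 hw1 _))
    have hwab := weight_inter_mul_union w α β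
    show weight w α * (∑ η, weight w η * ind (rEVT[U \ Z, A₁] ∩ rEVT[U \ Z, D₁] ∩
          rAVT[U \ Z, Tm, S \ ↑Z ∪ Ra]) η) *
        (weight w β * ∑ η, weight w η * ind (rEVT[U \ Z, A₂] ∩ rEVT[U \ Z, D₂] ∩
          rAVT[U \ Z, Tm, T \ ↑Z ∪ Rb]) η) ≤
      weight w (α ∩ β) * (∑ η, weight w η * ind (rEVT[U \ Z, A₁] ∩ rEVT[U \ Z, A₂] ∩
          rAVT[U \ Z, Tm, (S ∩ T) \ ↑Z ∪ rS U Z (α ∩ β)]) η) *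
        (weight w (α ∪ β) * ∑ η, weight w η * ind (rEVT[U \ Z, D₁] ∩ rEVT[U \ Z, D₂] ∩
          rAVT[U \ Z, Tm, (S ∪ T) \ ↑Z ∪ rS U Z (α ∪ β)]) η)
    calc weight w α * (∑ η, weight w η * ind (rEVT[U \ Z, A₁] ∩ rEVT[U \ Z, D₁] ∩
            rAVT[U \ Z, Tm, S \ ↑Z ∪ Ra]) η) *
          (weight w β * ∑ η, weight w η * ind (rEVT[U \ Z, A₂] ∩ rEVT[U \ Z, D₂] ∩
            rAVT[U \ Z, Tm, T \ ↑Z ∪ Rb]) η)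
        = (weight w α * weight w β) *
          ((∑ η, weight w η * ind (rEVT[U \ Z, A₁] ∩ rEVT[U \ Z, D₁] ∩
              rAVT[U \ Z, Tm, S \ ↑Z ∪ Ra]) η) *
            ∑ η, weight w η * ind (rEVT[U \ Z, A₂] ∩ rEVT[U \ Z, D₂] ∩
              rAVT[U \ Z, Tm, T \ ↑Z ∪ Rb]) η) := by ring
      _ ≤ (weight w (α ∩ β) * weight w (α ∪ β)) *
          ((∑ η, weight w η * ind (rEVT[U \ Z, A₁] ∩ rEVT[U \ Z, A₂] ∩
              rAVT[U \ Z, Tm, (S ∩ T) \ ↑Z ∪ rS U Z (α ∩ β)]) η) *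
            ∑ η, weight w η * ind (rEVT[U \ Z, D₁] ∩ rEVT[U \ Z, D₂] ∩
              rAVT[U \ Z, Tm, (S ∪ T) \ ↑Z ∪ rS U Z (α ∪ β)]) η) := by
          rw [hwab]
          exact mul_le_mul_of_nonneg_left hIH'
            (mul_nonneg (weight_nonneg hw0 hw1 _) (weight_nonneg hw0 hw1 _))
      _ = _ := by ring

end Events

end Summit.CriticalPhenomena.PercolationContinuityZ3.Theorems

end
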